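import Summits.BirchSwinnertonDyer.BirchSwinnertonDyer.Theorems.PrintCf2RubinValueTwoKatzJZeroUniqueSupply
import Literature.NumberTheory.EllipticCurves.DeShalit1987.KatzMeasureTranslate
import Literature.NumberTheory.EllipticCurves.ProfiniteGroupDistributionDivisionCocycle
import HarnessLib

/-!
# (T4) clause 2 at the level of measures: periods `(Ω, δ, Ω₂)` vs `(Ω, δ, t·Ω₂)` ⟹ `μ′ = δ_{h,0}μ`

Cell `bsd-print-cf2`, width seat `bsd-line-cf2-p1-w5` g15; construction lane of the print leaf
`KatzDistributionsAtTwoPrint` (stmt-24720) of crux `PrintCf2.SplitBadTwoRankOneOfFacts` (stmt-20368), director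
OPTION 1 (`j = 0` twin), planner (T4) «RIGIDITY LEAF SHAPE», clause 2: «(Ω, δ, Ω₂) vs (Ω, δ, tΩ₂),
t ∈ κ_v(I_v ∩ 𝒢) ⇒ Amice transforms differ by the unit l(h_t)(1+T₁)^{a_t}» ⇒ `(G₂′) = (G₂)` and
`‖G₂′(x,y)‖ = ‖G₂(x,y)‖`. Theorems only; no `sorry`. BSD is not proved by any of this; nothing is closed here.

THE COMPOSITION. LEAD g17's certificate `integral_avatar_twisting_zero_of_forall`
(`DeShalit1987/KatzMeasureTranslate.lean`, p758208): if `μ` satisfies the `(m,0)`-identities of II.4.14 / (50) for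
the periods `(Ω, δ, Ω_p)` and `ê(h) = t^m` on the range, then the translate `δ_{h,0}μ` satisfies them for
`(Ω, δ, t·Ω_p)`. Clause 1, proved under the endpoint's binders in `…KatzJZeroUniqueSupply.lean`
(`μ_eq_of_forall_identity_imaginaryQuadratic`, p762389): two distributions along the same tower with the SAME
identities are equal. Hence ANY `μ′` with the identities for `(Ω, δ, t·Ω_p)` IS `δ_{h,0}μ` cell by cell
(`μ_eq_twisting_of_forall_identity_imaginaryQuadratic`), its integrals are those of the translate
(`integral_eq_integral_twisting_of_forall_identity`), and its attached `ℤ₂²`-distribution along any independent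
pair differs from that of `μ` by the unit character factor `l(h)·F(κ₁h, κ₂h)` at every continuous character `F`
(`integral_katzDistribution₂_eq_unit_mul_of_forall_identity`, `norm_integral_katzDistribution₂_eq_of_forall_identity`,
`hasValueAt₂_amice₂Int_of_forall_identity`) — de Shalit II.4.17 (54): "`Ω_p` is determined up to a unit, and
changing it multiplies the measure by a translation".

## References

* [deShalit1987] E. de Shalit, *Iwasawa theory of elliptic curves with complex multiplication* (1987),
  II.4.12 (p. 66–68), II Thm. 4.14 (36) (p. 71), II.4.16 (49)–(50) (p. 76–77), II.4.17 (52)–(54) (p. 77–78).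
-/

noncomputable section

namespace Summit.BirchSwinnertonDyer.BirchSwinnertonDyer.Theorems.PrintCf2.KatzJZeroUnique

open scoped NumberField Classical
open NumberField IsDedekindDomain IsDedekindDomain.HeightOneSpectrum Field
open Literature.NumberTheory.EllipticCurves Literature.NumberTheory.GaloisRepresentations
open Literature.NumberTheory.NumberFields

set_option linter.dupNamespace false -- D-0017: single-problem summit, `…BirchSwinnertonDyer.BirchSwinnertonDyer…` repeats a namespace by design
set_option autoImplicit false

variable {K : Type} [Field K] [NumberField K]

section Endpoint

variable (hK : IsImaginaryQuadratic K) (hh : NumberField.classNumber K = 1) (ι : PadicAlgCl 2 ≃+* ℂ)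
  {v vbar : HeightOneSpectrum (𝓞 K)}
  (hv : ((2 : ℕ) : 𝓞 K) ∈ v.asIdeal) (hvbar : ((2 : ℕ) : 𝓞 K) ∈ vbar.asIdeal) (hne : vbar ≠ v)
  (hι : ∀ (w : InfinitePlace K) (k : 𝓞 K), k ∈ v.asIdeal ↔ ‖ι.symm (w.embedding (k : K))‖ < 1)
  {S : Finset (HeightOneSpectrum (𝓞 K))} (hvS : v ∉ S)
  {𝒰 : SubgroupTower (absoluteGaloisGroup K)} [∀ n, (𝒰.U n).Normal]
  (hopen : ∀ n, IsOpen (𝒰.U n : Set (absoluteGaloisGroup K)))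
  (hray : ⋂ n, (𝒰.U n : Set (absoluteGaloisGroup K)) ⊆ DeShalit1987.rayKer K 2 S)
  (hray' : ∀ n, DeShalit1987.rayKer K 2 S ≤ 𝒰.U n) {m₀ : ℕ} (hm₀ : 1 ≤ m₀)
  {Ω δ : ℂ} {Ωp t : ℂ_[2]} {μ μ' : GroupDistribution 𝒰 ℂ_[2]} {h : absoluteGaloisGroup K}
  (hμ : ∀ (ε : HeckeCharacter K) (e : FramedGaloisRep K (PadicAlgCl 2) 1) (m : ℕ),
    IsPAdicAvatarOutside S ι ε e → m₀ ≤ m →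
    ε.HasInfinityType (fun _ ↦ -(m : ℤ)) (fun _ ↦ ((0 : ℕ) : ℤ)) →
    (∀ w : HeightOneSpectrum (𝓞 K), w ∉ S → w ≠ vbar → ε.IsUnramifiedAt w) →
    𝒰.IsTowerContinuous (fun σ ↦ avatarValueAt e σ) →
    ∀ hL : LFunction.HasEntireContinuation (heckeLFunction ε),
      μ.integral (fun σ ↦ avatarValueAt e σ) =
        ((ι.symm (DeShalit1987.interpolationValue 2 v vbar S ε m 0 Ω δ (hL.continuation 0)) :
            PadicAlgCl 2) : ℂ_[2]) * Ωp ^ (m + 0))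
  (hμ' : ∀ (ε : HeckeCharacter K) (e : FramedGaloisRep K (PadicAlgCl 2) 1) (m : ℕ),
    IsPAdicAvatarOutside S ι ε e → m₀ ≤ m →
    ε.HasInfinityType (fun _ ↦ -(m : ℤ)) (fun _ ↦ ((0 : ℕ) : ℤ)) →
    (∀ w : HeightOneSpectrum (𝓞 K), w ∉ S → w ≠ vbar → ε.IsUnramifiedAt w) →
    𝒰.IsTowerContinuous (fun σ ↦ avatarValueAt e σ) →
    ∀ hL : LFunction.HasEntireContinuation (heckeLFunction ε),
      μ'.integral (fun σ ↦ avatarValueAt e σ) =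
        ((ι.symm (DeShalit1987.interpolationValue 2 v vbar S ε m 0 Ω δ (hL.continuation 0)) :
            PadicAlgCl 2) : ℂ_[2]) * (t * Ωp) ^ (m + 0))
  (hh' : ∀ (ε : HeckeCharacter K) (e : FramedGaloisRep K (PadicAlgCl 2) 1) (m : ℕ),
    IsPAdicAvatarOutside S ι ε e → m₀ ≤ m →
    ε.HasInfinityType (fun _ ↦ -(m : ℤ)) (fun _ ↦ ((0 : ℕ) : ℤ)) →
    (∀ w : HeightOneSpectrum (𝓞 K), w ∉ S → w ≠ vbar → ε.IsUnramifiedAt w) →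
    avatarValueAt e h = t ^ m)

include hK hh hv hvbar hne hι hvS hopen hray hray' hm₀ hμ hμ' hh' in
/-- ★★★ **(T4) CLAUSE 2 AT MEASURE LEVEL: a change `Ω₂ ↦ t·Ω₂` of the `2`-adic period IS a translation.** Under
the endpoint's binders (`K` imaginary quadratic, `h_K = 1`, `2 ∈ v, v̄`, `v̄ ≠ v`, frame `hι`, `v ∉ S`, a tower of
open NORMAL subgroups with `⋂ U_n ⊆ rayKer K 2 S ≤ U_n`, `m₀ ≥ 1`): if `μ` satisfies the R3 `(m,0)`-identities
for `(Ω, δ, Ω₂)`, `μ′` satisfies them for `(Ω, δ, t·Ω₂)`, and `h ∈ Γ_K` has `ê(h) = t^m` on the range, then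
`μ′ = δ_{h,0}μ` on every cell. (`δ_{h,0}μ` has the `(Ω, δ, t·Ω₂)`-identities by
`integral_avatar_twisting_zero_of_forall`; conclude by clause 1 `μ_eq_of_forall_identity_imaginaryQuadratic`.)
[cite: deShalit1987, II.4.17 (54) (p. 78), II.4.12 (p. 67), II Thm. 4.14 (p. 71)] -/
theorem μ_eq_twisting_of_forall_identity_imaginaryQuadratic (N : ℕ) (a : absoluteGaloisGroup K ⧸ 𝒰.U N) :
    μ'.μ N a = (GroupDistribution.twisting h 0 μ).μ N a :=
  μ_eq_of_forall_identity_imaginaryQuadratic hK hh ι hv hvbar hne hι hvS hopen hray hray' hm₀ μ'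
    (GroupDistribution.twisting h 0 μ)
    (fun ε m hL ↦ ((ι.symm (DeShalit1987.interpolationValue 2 v vbar S ε m 0 Ω δ (hL.continuation 0)) :
      PadicAlgCl 2) : ℂ_[2]) * (t * Ωp) ^ (m + 0))
    hμ' (integral_avatar_twisting_zero_of_forall hμ hh') N a

include hK hh hv hvbar hne hι hvS hopen hray hray' hm₀ hμ hμ' hh' in
/-- ★★ **Integrals of `μ′` are integrals of the translate**: `∫ f dμ′ = ∫ f d(δ_{h,0}μ) (= ∫ f(h·x) dμ(x))` for
EVERY `f` (the integral only reads the cell values). [cite: deShalit1987, II.4.17 (54) (p. 78), I.3.1 (p. 16)] -/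
theorem integral_eq_integral_twisting_of_forall_identity (f : absoluteGaloisGroup K → ℂ_[2]) :
    μ'.integral f = (GroupDistribution.twisting h 0 μ).integral f :=
  GroupDistribution.integral_congr_of_μ_eq μ' _
    (fun N a ↦ μ_eq_twisting_of_forall_identity_imaginaryQuadratic hK hh ι hv hvbar hne hι hvS hopen hray hray'
      hm₀ hμ hμ' hh' N a) f

include hK hh hv hvbar hne hι hvS hopen hray hray' hm₀ hμ hμ' hh' in
/-- ★★ **The attached `ℤ₂²`-distributions differ by a unit character factor**: along any pair `(κ₁, κ₂)` with
tower-continuous coordinates and any tower-continuous twist `l`,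
`∫ F dπ_*(l·μ′) = l(h)·F(κ₁h, κ₂h)·∫ F dπ_*(l·μ)` for every continuous character `F` of `ℤ₂²`.
[cite: deShalit1987, II.4.16 (49) (p. 76), II.4.17 (54) (p. 78)] -/
theorem integral_katzDistribution₂_eq_unit_mul_of_forall_identity {κ₁ κ₂ : ZpExtension K 2}
    (hpc : 𝒰.IsTowerContinuous (ZpExtension.pairCoord κ₁ κ₂)) (l : FramedGaloisRep K (PadicAlgCl 2) 1)
    (hl : 𝒰.IsTowerContinuous (fun σ ↦ avatarValueAt l σ)) {F : ℤ_[2] × ℤ_[2] → ℂ_[2]}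
    (hF : IsContinuousChar₂ F) :
    (katzDistribution₂ μ' hpc l hl).integral F =
      avatarValueAt l h * F (ZpExtension.pairCoord κ₁ κ₂ h) * (katzDistribution₂ μ hpc l hl).integral F := by
  rw [← integral_katzDistribution₂_twisting_zero_of_isContinuousChar₂ μ hpc l hl h hF,
    integral_katzDistribution₂ _ hpc l hl hF.uniformContinuous (fun x ↦ (hF.norm_apply_eq_one x).le),
    integral_katzDistribution₂ _ hpc l hl hF.uniformContinuous (fun x ↦ (hF.norm_apply_eq_one x).le)]
  exact integral_eq_integral_twisting_of_forall_identity hK hh ι hv hvbar hne hι hvS hopen hray hray' hm₀ hμ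
    hμ' hh' _

include hK hh hv hvbar hne hι hvS hopen hray hray' hm₀ hμ hμ' hh' in
/-- ★★ **SAME NORM of the `ℤ₂²`-integrals of `μ′` and `μ`** at every continuous character of `ℤ₂²` — the
invariance `‖G₂′(x,y)‖ = ‖G₂(x,y)‖` read by the value-formula consumers of the print leaf.
[cite: deShalit1987, II.4.17 (54) (p. 78)] -/
theorem norm_integral_katzDistribution₂_eq_of_forall_identity {κ₁ κ₂ : ZpExtension K 2}
    (hpc : 𝒰.IsTowerContinuous (ZpExtension.pairCoord κ₁ κ₂)) (l : FramedGaloisRep K (PadicAlgCl 2) 1)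
    (hl : 𝒰.IsTowerContinuous (fun σ ↦ avatarValueAt l σ)) {F : ℤ_[2] × ℤ_[2] → ℂ_[2]}
    (hF : IsContinuousChar₂ F) :
    ‖(katzDistribution₂ μ' hpc l hl).integral F‖ = ‖(katzDistribution₂ μ hpc l hl).integral F‖ := by
  rw [integral_katzDistribution₂_eq_unit_mul_of_forall_identity hK hh ι hv hvbar hne hι hvS hopen hray hray' hm₀
    hμ hμ' hh' hpc l hl hF, norm_mul, norm_mul, norm_avatarValueAt_eq_one, hF.norm_apply_eq_one, one_mul, one_mul]

include hK hh hv hvbar hne hι hvS hopen hray hray' hm₀ hμ hμ' hh' in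
/-- ★★ **The two-variable Amice transforms at character points**: `G₂′(x, y) = u(x, y)·G₂(x, y)` with
`u(x,y) = l(h)·F(κ₁h, κ₂h)` of norm `1`, at `(x, y) = (F(1,0) − 1, F(0,1) − 1)` — for ANY `μ′` with the
`(Ω, δ, t·Ω₂)`-identities, not only for the translate. [cite: deShalit1987, II.4.17 (52)–(54) (p. 77–78)] -/
theorem hasValueAt₂_amice₂Int_of_forall_identity {κ₁ κ₂ : ZpExtension K 2}
    (hpc : 𝒰.IsTowerContinuous (ZpExtension.pairCoord κ₁ κ₂)) (l : FramedGaloisRep K (PadicAlgCl 2) 1)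
    (hl : 𝒰.IsTowerContinuous (fun σ ↦ avatarValueAt l σ)) {F : ℤ_[2] × ℤ_[2] → ℂ_[2]}
    (hF : IsContinuousChar₂ F) (hb' : (katzDistribution₂ μ' hpc l hl).bound ≤ 1) :
    IntSeries.HasValueAt₂ ((katzDistribution₂ μ' hpc l hl).amice₂Int hb') (F (1, 0) - 1) (F (0, 1) - 1)
      (avatarValueAt l h * F (ZpExtension.pairCoord κ₁ κ₂ h) * (katzDistribution₂ μ hpc l hl).integral F) := by
  rw [← integral_katzDistribution₂_eq_unit_mul_of_forall_identity hK hh ι hv hvbar hne hι hvS hopen hray hray'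
    hm₀ hμ hμ' hh' hpc l hl hF]
  exact BoundedDistribution.hasValueAt₂_amice₂Int _ hb' hF

end Endpoint

end Summit.BirchSwinnertonDyer.BirchSwinnertonDyer.Theorems.PrintCf2.KatzJZeroUnique
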